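import Mathlib
import HarnessLib
import Summits.ValiantsHypothesis.ValiantsHypothesis.Theorems.BiSetMultilinearAvail
import Summits.ValiantsHypothesis.ValiantsHypothesis.Theorems.ColumnSubsetDP

/-!
# Bi-set-multilinear circuits: the Laplace (column-subset) DP — the matching `2^{O(n)}` upper bound

Companion of `BiSetMultilinearCounting.lean` / `BiSetMultilinearPrograms.lean` (workshop
`decomp-valiant`, lens 6, generation 25; census cell D3; CALIBRATION only — `VP ≠ VNP` is NOT proved,
LADDER-Valiant rung 0). Those files prove the LOWER bound: every bi-set-multilinear straight-line
program (`Prog`) one of whose gates unfolds to a well-formed term with all columns computing `per_N` or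
`det_N` has length `≥ C(N, ⌈N/3⌉) = 2^{Ω(N)}` (`Prog.perPoly_lower_bound`, `Prog.detPoly_lower_bound`),
and record that "the matching `O(N 2^N)` Laplace-type upper bound is not formalised". This file
formalises it, in the SAME model, so that cell D3 reads `2^{Θ(N)}` with both bounds kernel-checked:

* (bookkeeping `Prog.Avail`, `Prog.avail_input/const/mul/smul/add`, `Prog.avail_list_sum`,
  `Prog.iterate` is in `BiSetMultilinearAvail.lean`;)
* `Prog.RowStep`, `Prog.exists_bsm_of_rowStep` — the generic DP: a table `F j S` (`j ≤ n`, `|S| = j`)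
  with `F 0 ∅ = 1` whose entries at stage `j+1` are nonempty sums of `≤ j+1` signed terms
  `a • (x_{j,c} · F j (S ∖ c))`, `c ∈ S` (expansion along the row `j`), is computed at its top entry
  `F n univ` by a program of length `≤ 4(n+1)2^n` at a well-formed gate with label `(univ, univ)` —
  the entry `F j S` carries the label `(rows < j, S)`, so every product joins the row `{j}` to the rows
  `< j` and the column `{c}` to `S ∖ c` (disjoint), and every sum joins equal labels;
* `Prog.exists_bsm_perPoly` (`F = ` the sub-permanents `ColumnSubsetDP.subperm`, all signs `+1`,
  recurrence `ColumnSubsetDP.subperm_succ`) and `Prog.exists_bsm_detPoly` (`F = ` the signed minors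
  `Prog.subdet`, Laplace expansion `Prog.subdet_succ` along the last row via `Matrix.det_succ_row`):
  `per_n` and `det_n` have bi-set-multilinear programs of length `≤ 4(n+1)2^n`;
* `Prog.bsm_perPoly_sandwich`, `Prog.bsm_detPoly_sandwich` — both bounds side by side (`n ≥ 2`,
  nontrivial commutative ring): the model is exponential for BOTH polynomials and DET-BLIND (it does
  not separate `det` from `per`), which is why D3 is a calibration and not a route.

References: the row-expansion DP for the permanent is [Ryser1963] H. J. Ryser, *Combinatorial
Mathematics* (1963), Ch. 2 §5 (as in `ColumnSubsetDP.lean`, whose polynomial identities are reused);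
the label-counting lower bound it matches is modelled on [JerrumSnir1982] M. Jerrum, M. Snir,
J. ACM 29 (1982) 874–897, §3.
-/

noncomputable section

open MvPolynomial Finset

open scoped Nat

-- lint debt (as in every `…ValiantsHypothesis.Theorems.*` file): the mandated namespace repeats a component.
set_option linter.dupNamespace false

namespace Summit.ValiantsHypothesis.ValiantsHypothesis.Theorems.BiSetMultilinearCounting

open Literature.Computability.AlgebraicComplexity

universe u v

/-! ### Row-expansion schemes and the generic DP -/

namespace Prog

open Summit.ValiantsHypothesis.ValiantsHypothesis.Theorems.ColumnSubsetDP
  (rowsLT subperm erase_rowsLT_succ mem_rowsLT_succ not_mem_rowsLT subperm_succ subperm_zero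
    subperm_full)

variable {k : Type u} [CommRing k]

/-- The first `0` rows: none. [folklore] -/
theorem rowsLT_zero (n : ℕ) : rowsLT n 0 = ∅ := by
  ext r; simp [rowsLT]

/-- The first `n` rows: all of them. [folklore] -/
theorem rowsLT_self (n : ℕ) : rowsLT n n = (univ : Finset (Fin n)) := by
  ext r; simp [rowsLT]

/-- Adding the row `j` to the first `j` rows gives the first `j+1` rows. [folklore] -/
theorem singleton_union_rowsLT {n j : ℕ} (hj : j < n) :
    ({(⟨j, hj⟩ : Fin n)} : Finset (Fin n)) ∪ rowsLT n j = rowsLT n (j + 1) := by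
  rw [← erase_rowsLT_succ hj, ← insert_eq, insert_erase (mem_rowsLT_succ hj)]

/-- A ROW-EXPANSION STEP for a table `F : ℕ → Finset (Fin n) → k[x]` at `(j+1, S')`: the entry
`F (j+1) S'` is a nonempty sum of at most `j+1` signed terms `a • (x_{j,c} · F j (S' ∖ c))` with
`c ∈ S'` (Laplace expansion along the row `j`; `a = 1` for the permanent, `a = ±1` for the determinant).
[cite: Ryser1963, Ch. 2 §5] -/
def RowStep (n : ℕ) (F : ℕ → Finset (Fin n) → MvPolynomial (Fin n × Fin n) k) (j : ℕ)
    (hj : j < n) (S' : Finset (Fin n)) : Prop :=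
  ∃ l : List (k × Fin n), l ≠ [] ∧ l.length ≤ j + 1 ∧ (∀ ac ∈ l, ac.2 ∈ S') ∧
    F (j + 1) S' = (l.map fun ac => ac.1 • (X (⟨j, hj⟩, ac.2) * F j (S'.erase ac.2))).sum

/-- **One table entry.** If every `F j S''` (`|S''| = j`) is available with label `(rows < j, S'')`
and `F` has a row-expansion step at `(j+1, S')`, then `≤ 4(j+1)` more instructions make `F (j+1) S'`
available with label `(rows < j+1, S')`: per summand one `input x_{j,c}`, one row- and column-disjoint
`mul` with `F j (S' ∖ c)`, one `smul`, and one `add` into the running sum — all summands carry the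
SAME label `(rows < j+1, S')`, so every `add` is legal. [cite: Ryser1963, Ch. 2 §5] -/
theorem rowStep_entry (n : ℕ) (F : ℕ → Finset (Fin n) → MvPolynomial (Fin n × Fin n) k)
    {j : ℕ} (hj : j < n) (S' : Finset (Fin n)) (hS' : S'.card = j + 1) (hstep : RowStep n F j hj S')
    (P : Prog k (Fin n))
    (havail : ∀ S'' : Finset (Fin n), S''.card = j → Avail P (F j S'') (rowsLT n j) S'') :
    ∃ Q : Prog k (Fin n), Q.length ≤ 4 * (j + 1) ∧
      Avail (P ++ Q) (F (j + 1) S') (rowsLT n (j + 1)) S' := by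
  classical
  obtain ⟨l, hne, hlen, hmem, hF⟩ := hstep
  set p₀ : Fin n := ⟨j, hj⟩ with hp₀def
  set t : k × Fin n → MvPolynomial (Fin n × Fin n) k := fun ac =>
    ac.1 • (X (p₀, ac.2) * F j (S'.erase ac.2)) with htdef
  obtain ⟨Q, hQ, hav⟩ := avail_list_sum t (rowsLT n (j + 1)) S' 3 l hne P (by
    intro ac hac P' hP'
    have hc : ac.2 ∈ S' := hmem ac hac
    have hcard : (S'.erase ac.2).card = j := by rw [Finset.card_erase_of_mem hc, hS']; rfl
    have hx : Avail (P' ++ [Instr.input p₀ ac.2]) (X (p₀, ac.2)) {p₀} {ac.2} :=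
      avail_input P' p₀ ac.2
    have hq : Avail (P' ++ [Instr.input p₀ ac.2]) (F j (S'.erase ac.2)) (rowsLT n j)
        (S'.erase ac.2) :=
      ((havail (S'.erase ac.2) hcard).of_prefix hP').mono _
    obtain ⟨ins₁, hmul⟩ := avail_mul hx hq
      (by rw [Finset.disjoint_singleton_left]; exact not_mem_rowsLT hj)
      (by rw [Finset.disjoint_singleton_left]; exact Finset.notMem_erase ac.2 S')
    obtain ⟨ins₂, hsmul⟩ := avail_smul hmul ac.1
    refine ⟨[Instr.input p₀ ac.2] ++ [ins₁] ++ [ins₂], by simp, ?_⟩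
    rw [singleton_union_rowsLT hj, ← insert_eq, insert_erase hc] at hsmul
    simpa [List.append_assoc] using hsmul)
  refine ⟨Q, ?_, ?_⟩
  · calc Q.length ≤ l.length * (3 + 1) := hQ
      _ ≤ (j + 1) * (3 + 1) := Nat.mul_le_mul_right _ hlen
      _ = 4 * (j + 1) := by ring
  · rw [hF]; exact hav

/-- **One stage.** From all `F j ·` to all `F (j+1) ·`: at most `4(j+1)·C(n, j+1)` instructions.
[cite: Ryser1963, Ch. 2 §5] -/
theorem rowStep_stage (n : ℕ) (F : ℕ → Finset (Fin n) → MvPolynomial (Fin n × Fin n) k)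
    {j : ℕ} (hj : j < n) (hstep : ∀ S' : Finset (Fin n), S'.card = j + 1 → RowStep n F j hj S')
    (P : Prog k (Fin n))
    (havail : ∀ S'' : Finset (Fin n), S''.card = j → Avail P (F j S'') (rowsLT n j) S'') :
    ∃ Q : Prog k (Fin n),
      Q.length ≤ 4 * (j + 1) * ((univ : Finset (Fin n)).powersetCard (j + 1)).card ∧
      ∀ S' : Finset (Fin n), S'.card = j + 1 →
        Avail (P ++ Q) (F (j + 1) S') (rowsLT n (j + 1)) S' := by
  classical
  set L := ((univ : Finset (Fin n)).powersetCard (j + 1)).toList with hLdef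
  obtain ⟨Q, hQ, hgood⟩ := iterate
    (Good := fun (S' : Finset (Fin n)) (P' : Prog k (Fin n)) =>
      Avail P' (F (j + 1) S') (rowsLT n (j + 1)) S')
    (fun S' P' Q' h => h.mono Q') (4 * (j + 1)) L P (by
      intro S' hS'L P' hP'
      have hcard : S'.card = j + 1 := by
        rw [hLdef, Finset.mem_toList, Finset.mem_powersetCard] at hS'L; exact hS'L.2
      exact rowStep_entry n F hj S' hcard (hstep S' hcard) P'
        (fun S'' hS'' => (havail S'' hS'').of_prefix hP'))
  refine ⟨Q, ?_, fun S' hS' => hgood S' ?_⟩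
  · rw [hLdef, Finset.length_toList] at hQ
    simpa [mul_comm, mul_assoc, mul_left_comm] using hQ
  · rw [hLdef, Finset.mem_toList, Finset.mem_powersetCard]
    exact ⟨Finset.subset_univ _, hS'⟩

/-- **All stages.** If `F 0 ∅ = 1` and `F` has a row-expansion step at every `(j+1, S')` with
`j < n`, `|S'| = j+1`, then for every `j ≤ n` some program of length
`≤ 4(n+1)·Σ_{i ≤ j} C(n, i)` makes every `F j S` (`|S| = j`) available with label `(rows < j, S)`;
stage `0` is the single instruction `const 1` (label `(∅, ∅)`). [cite: Ryser1963, Ch. 2 §5] -/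
theorem rowStep_tables (n : ℕ) (F : ℕ → Finset (Fin n) → MvPolynomial (Fin n × Fin n) k)
    (h0 : F 0 ∅ = 1)
    (hstep : ∀ (j : ℕ) (hj : j < n) (S' : Finset (Fin n)), S'.card = j + 1 → RowStep n F j hj S') :
    ∀ j ≤ n, ∃ P : Prog k (Fin n),
      P.length ≤ 4 * (n + 1) * ∑ i ∈ range (j + 1), n.choose i ∧
        ∀ S : Finset (Fin n), S.card = j → Avail P (F j S) (rowsLT n j) S := by
  classical
  intro j
  induction j with
  | zero =>
    intro _
    refine ⟨[] ++ [Instr.const 1], ?_, ?_⟩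
    · simp only [List.nil_append, List.length_singleton, zero_add, Finset.range_one,
        Finset.sum_singleton, Nat.choose_zero_right, mul_one]
      omega
    intro S hS
    rw [Finset.card_eq_zero] at hS
    subst hS
    have h := avail_const (k := k) (ι := Fin n) [] 1
    rw [C_1, ← h0] at h
    rw [rowsLT_zero]
    exact h
  | succ j ih =>
    intro hjn
    obtain ⟨P, hlen, hav⟩ := ih (Nat.le_of_succ_le hjn)
    obtain ⟨Q, hQ, hav'⟩ := rowStep_stage n F (Nat.lt_of_succ_le hjn)
      (hstep j (Nat.lt_of_succ_le hjn)) P hav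
    refine ⟨P ++ Q, ?_, hav'⟩
    have hc : ((univ : Finset (Fin n)).powersetCard (j + 1)).card = n.choose (j + 1) := by
      rw [Finset.card_powersetCard, Finset.card_univ, Fintype.card_fin]
    have h1 : 4 * (j + 1) * ((univ : Finset (Fin n)).powersetCard (j + 1)).card ≤
        4 * (n + 1) * n.choose (j + 1) := by
      rw [hc]; exact Nat.mul_le_mul_right _ (Nat.mul_le_mul_left _ (by omega))
    rw [Finset.sum_range_succ, Nat.mul_add, List.length_append]
    exact Nat.add_le_add hlen (hQ.trans h1)

/-- **The generic DP.** A table with `F 0 ∅ = 1` and row-expansion steps is computed, at its top entry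
`F n univ`, by a bi-set-multilinear program of length `≤ 4(n+1)2^n` at a well-formed gate with the
full label `(univ, univ)`. [cite: Ryser1963, Ch. 2 §5] -/
theorem exists_bsm_of_rowStep (n : ℕ) (F : ℕ → Finset (Fin n) → MvPolynomial (Fin n × Fin n) k)
    (h0 : F 0 ∅ = 1)
    (hstep : ∀ (j : ℕ) (hj : j < n) (S' : Finset (Fin n)), S'.card = j + 1 → RowStep n F j hj S')
    {f : MvPolynomial (Fin n × Fin n) k} (htop : F n univ = f) :
    ∃ P : Prog k (Fin n), P.length ≤ 4 * (n + 1) * 2 ^ n ∧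
      ∃ g ∈ gates [] P, g.WF ∧ g.rows = univ ∧ g.cols = univ ∧ g.eval = f := by
  classical
  obtain ⟨P, hlen, hav⟩ := rowStep_tables (k := k) n F h0 hstep n le_rfl
  have h := hav univ (by rw [Finset.card_univ, Fintype.card_fin])
  rw [htop, rowsLT_self] at h
  refine ⟨P, ?_, h.exists_mem⟩
  rw [← Nat.sum_range_choose n]
  exact hlen

/-! ### Instance 1: the permanent (column-subset DP, all signs `+1`) -/

/-- The sub-permanents `q(j, S)` have row-expansion steps (with coefficients `1`):
`q(j+1, S') = Σ_{c ∈ S'} 1 • (x_{j,c} · q(j, S' ∖ c))`. [cite: Ryser1963, Ch. 2 §5] -/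
theorem rowStep_subperm (n : ℕ) (j : ℕ) (hj : j < n) (S' : Finset (Fin n)) (hS' : S'.card = j + 1) :
    RowStep n (subperm k n) j hj S' := by
  refine ⟨S'.toList.map (fun c => ((1 : k), c)), ?_, ?_, ?_, ?_⟩
  · rw [ne_eq, List.map_eq_nil_iff, Finset.toList_eq_nil, ← Finset.card_eq_zero, hS']; omega
  · rw [List.length_map, Finset.length_toList, hS']
  · intro ac hac
    rw [List.mem_map] at hac
    obtain ⟨c, hc, rfl⟩ := hac
    exact Finset.mem_toList.1 hc
  · rw [subperm_succ (R := k) hj S', List.map_map, Finset.sum_map_toList]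
    exact Finset.sum_congr rfl (fun c _ => by simp)

/-- **`per_n` by a bi-set-multilinear program of length `≤ 4(n+1)2^n`** (UPPER half of census cell D3
for the permanent, in the model of `BiSetMultilinearPrograms`). [cite: Ryser1963, Ch. 2 §5] -/
theorem exists_bsm_perPoly (n : ℕ) :
    ∃ P : Prog k (Fin n), P.length ≤ 4 * (n + 1) * 2 ^ n ∧
      ∃ g ∈ gates [] P, g.WF ∧ g.rows = univ ∧ g.cols = univ ∧ g.eval = perPoly (Fin n) k :=
  exists_bsm_of_rowStep n (subperm k n) (subperm_zero (R := k) n) (rowStep_subperm n)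
    (subperm_full (R := k) n)

/-! ### Instance 2: the determinant (signed column-subset DP) -/

/-- The signed minor `d(j, S)`: the determinant of the generic matrix on the first `j ≤ n` rows and the
columns of `S` (`|S| = j`) listed increasingly. [cite: Ryser1963, Ch. 2 §5] -/
def subdet (k : Type u) [CommRing k] (n j : ℕ) (hj : j ≤ n) (S : Finset (Fin n)) (hS : S.card = j) :
    MvPolynomial (Fin n × Fin n) k :=
  (Matrix.of fun i i' : Fin j =>
    (X (Fin.castLE hj i, S.orderEmbOfFin hS i') : MvPolynomial (Fin n × Fin n) k)).det

/-- The signed minors as a total table (`0` off the meaningful range). [folklore] -/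
def subdetTable (k : Type u) [CommRing k] (n j : ℕ) (S : Finset (Fin n)) :
    MvPolynomial (Fin n × Fin n) k :=
  if h : j ≤ n ∧ S.card = j then subdet k n j h.1 S h.2 else 0

/-- On the meaningful range the table is the signed minor. [folklore] -/
theorem subdetTable_eq {n j : ℕ} (hj : j ≤ n) {S : Finset (Fin n)} (hS : S.card = j) :
    subdetTable k n j S = subdet k n j hj S hS := by
  unfold subdetTable; rw [dif_pos ⟨hj, hS⟩]

/-- `d(0, ∅) = 1`. [folklore] -/
theorem subdetTable_zero (n : ℕ) : subdetTable k n 0 ∅ = 1 := by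
  rw [subdetTable_eq (Nat.zero_le n) Finset.card_empty]
  exact Matrix.det_fin_zero

/-- `d(n, univ) = det_n`. [cite: Ryser1963, Ch. 2 §5] -/
theorem subdetTable_full (n : ℕ) : subdetTable k n n univ = detPoly (Fin n) k := by
  classical
  have hcard : (univ : Finset (Fin n)).card = n := by rw [Finset.card_univ, Fintype.card_fin]
  rw [subdetTable_eq le_rfl hcard]
  unfold subdet Literature.Computability.AlgebraicComplexity.detPoly
  have hid : (id : Fin n → Fin n) = (univ : Finset (Fin n)).orderEmbOfFin hcard :=
    Finset.orderEmbOfFin_unique hcard (fun x => Finset.mem_univ _) strictMono_id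
  congr 1
  ext i i' : 1
  rw [Matrix.of_apply, Matrix.mvPolynomialX_apply, ← congrFun hid i']
  exact congrArg X (Prod.ext (Fin.ext (by simp)) rfl)

/-- Removing the `y`-th smallest column of a `(j+1)`-set leaves a `j`-set. [folklore] -/
theorem card_erase_orderEmbOfFin {n j : ℕ} {S' : Finset (Fin n)} (hS' : S'.card = j + 1)
    (y : Fin (j + 1)) : (S'.erase (S'.orderEmbOfFin hS' y)).card = j := by
  rw [Finset.card_erase_of_mem (Finset.orderEmbOfFin_mem S' hS' y), hS']; rfl

/-- The increasing enumeration of `S' ∖ {y-th smallest}` is the enumeration of `S'` skipping `y`.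
[folklore] -/
theorem orderEmbOfFin_erase {n j : ℕ} {S' : Finset (Fin n)} (hS' : S'.card = j + 1)
    (y : Fin (j + 1)) (i' : Fin j) :
    (S'.erase (S'.orderEmbOfFin hS' y)).orderEmbOfFin (card_erase_orderEmbOfFin hS' y) i' =
      S'.orderEmbOfFin hS' (y.succAbove i') := by
  have hu := Finset.orderEmbOfFin_unique (card_erase_orderEmbOfFin hS' y)
    (f := fun i' : Fin j => S'.orderEmbOfFin hS' (y.succAbove i'))
    (fun x => Finset.mem_erase.2
      ⟨fun h => Fin.succAbove_ne y x ((S'.orderEmbOfFin hS').injective h),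
        Finset.orderEmbOfFin_mem S' hS' _⟩)
    ((S'.orderEmbOfFin hS').strictMono.comp (Fin.strictMono_succAbove y))
  exact (congrFun hu i').symm

/-- **Laplace expansion of the signed minor along its last row `j`:**
`d(j+1, S') = Σ_{y < j+1} (-1)^{j+y} • (x_{j, c_y} · d(j, S' ∖ c_y))`, `c_y` the `y`-th smallest
column of `S'`. [cite: Ryser1963, Ch. 2 §5] -/
theorem subdet_succ {n j : ℕ} (hj : j < n) (S' : Finset (Fin n)) (hS' : S'.card = j + 1) :
    subdet k n (j + 1) hj S' hS' =
      ∑ y : Fin (j + 1), ((-1 : k) ^ (j + (y : ℕ))) •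
        (X (⟨j, hj⟩, S'.orderEmbOfFin hS' y) *
          subdet k n j hj.le (S'.erase (S'.orderEmbOfFin hS' y)) (card_erase_orderEmbOfFin hS' y)) := by
  unfold subdet
  rw [Matrix.det_succ_row _ (Fin.last j)]
  refine Finset.sum_congr rfl (fun y _ => ?_)
  have hsub : (Matrix.of fun i i' : Fin (j + 1) =>
      (X (Fin.castLE hj i, S'.orderEmbOfFin hS' i') : MvPolynomial (Fin n × Fin n) k)).submatrix
        (Fin.last j).succAbove y.succAbove =
      Matrix.of fun i i' : Fin j =>
        (X (Fin.castLE hj.le i, (S'.erase (S'.orderEmbOfFin hS' y)).orderEmbOfFin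
          (card_erase_orderEmbOfFin hS' y) i') : MvPolynomial (Fin n × Fin n) k) := by
    ext i i' : 1
    rw [Matrix.submatrix_apply, Matrix.of_apply, Matrix.of_apply, orderEmbOfFin_erase hS' y i',
      Fin.succAbove_last]
    exact congrArg X (Prod.ext (Fin.ext (by simp)) rfl)
  have hrow : Fin.castLE hj (Fin.last j) = (⟨j, hj⟩ : Fin n) := Fin.ext (by simp)
  rw [hsub, Matrix.of_apply, hrow, Fin.val_last, MvPolynomial.smul_eq_C_mul, map_pow, map_neg,
    map_one, mul_assoc]

/-- The signed minors have row-expansion steps (coefficients `±1`). [cite: Ryser1963, Ch. 2 §5] -/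
theorem rowStep_subdetTable (n : ℕ) (j : ℕ) (hj : j < n) (S' : Finset (Fin n))
    (hS' : S'.card = j + 1) : RowStep n (subdetTable k n) j hj S' := by
  refine ⟨(univ : Finset (Fin (j + 1))).toList.map
      (fun y : Fin (j + 1) => ((-1 : k) ^ (j + (y : ℕ)), S'.orderEmbOfFin hS' y)), ?_, ?_, ?_, ?_⟩
  · rw [ne_eq, List.map_eq_nil_iff, Finset.toList_eq_nil]
    exact Finset.univ_nonempty.ne_empty
  · rw [List.length_map, Finset.length_toList, Finset.card_univ, Fintype.card_fin]
  · intro ac hac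
    rw [List.mem_map] at hac
    obtain ⟨y, _, rfl⟩ := hac
    exact Finset.orderEmbOfFin_mem S' hS' y
  · rw [subdetTable_eq hj hS', subdet_succ hj S' hS', List.map_map, Finset.sum_map_toList]
    exact Finset.sum_congr rfl (fun y _ => by
      simp only [Function.comp_apply, subdetTable_eq hj.le (card_erase_orderEmbOfFin hS' y)])

/-- **`det_n` by a bi-set-multilinear program of length `≤ 4(n+1)2^n`** (UPPER half of census cell D3
for the determinant). [cite: Ryser1963, Ch. 2 §5] -/
theorem exists_bsm_detPoly (n : ℕ) :
    ∃ P : Prog k (Fin n), P.length ≤ 4 * (n + 1) * 2 ^ n ∧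
      ∃ g ∈ gates [] P, g.WF ∧ g.rows = univ ∧ g.cols = univ ∧ g.eval = detPoly (Fin n) k :=
  exists_bsm_of_rowStep n (subdetTable k n) (subdetTable_zero n) (rowStep_subdetTable n)
    (subdetTable_full n)

/-! ### The sandwich: census cell D3 with both bounds kernel -/

/-- **Sandwich for `per_n`.** In the bi-set-multilinear program model (`n ≥ 2`, nontrivial commutative
ring): SOME program of length `≤ 4(n+1)2^n` computes `per_n` at a well-formed gate with full label,
and EVERY program computing it at a well-formed gate with all columns has length
`≥ C(n, ⌊(n+2)/3⌋)` (`Prog.perPoly_lower_bound`), i.e. `2^{Θ(n)}` both ways. [cite: Ryser1963, Ch. 2 §5]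
[cite: JerrumSnir1982, §3] -/
theorem bsm_perPoly_sandwich (n : ℕ) (hn : 2 ≤ n) [Nontrivial k] :
    (∃ P : Prog k (Fin n), P.length ≤ 4 * (n + 1) * 2 ^ n ∧
      ∃ g ∈ gates [] P, g.WF ∧ g.rows = univ ∧ g.cols = univ ∧ g.eval = perPoly (Fin n) k) ∧
    (∀ P : Prog k (Fin n), ∀ g ∈ gates [] P,
      g.WF → g.cols = univ → g.eval = perPoly (Fin n) k → n.choose (Term.third n) ≤ P.length) := by
  refine ⟨exists_bsm_perPoly n, fun P g hg hwf hcols heval => ?_⟩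
  have h := Prog.perPoly_lower_bound (k := k) (ι := Fin n) (by simpa using hn) P hg hwf hcols heval
  simpa using h

/-- **Sandwich for `det_n`** (same model, same bounds): the model is DET-BLIND — it cannot separate
the determinant from the permanent. [cite: Ryser1963, Ch. 2 §5] [cite: JerrumSnir1982, §3] -/
theorem bsm_detPoly_sandwich (n : ℕ) (hn : 2 ≤ n) [Nontrivial k] :
    (∃ P : Prog k (Fin n), P.length ≤ 4 * (n + 1) * 2 ^ n ∧
      ∃ g ∈ gates [] P, g.WF ∧ g.rows = univ ∧ g.cols = univ ∧ g.eval = detPoly (Fin n) k) ∧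
    (∀ P : Prog k (Fin n), ∀ g ∈ gates [] P,
      g.WF → g.cols = univ → g.eval = detPoly (Fin n) k → n.choose (Term.third n) ≤ P.length) := by
  refine ⟨exists_bsm_detPoly n, fun P g hg hwf hcols heval => ?_⟩
  have h := Prog.detPoly_lower_bound (k := k) (ι := Fin n) (by simpa using hn) P hg hwf hcols heval
  simpa using h

end Prog

end Summit.ValiantsHypothesis.ValiantsHypothesis.Theorems.BiSetMultilinearCounting
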